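import Literature.RepresentationTheory.HeisenbergGroup.WeylSystemLatticePairUniqueness
import Literature.RepresentationTheory.HeisenbergGroup.HeisenbergCentralCharacterReduction
import HarnessLib

/-!
# Uniqueness of the irreducible representation of a real Heisenberg group times a commuting lattice-pair Heisenberg
# group — the shape `H(W_∞) · H(W_fin)` of the adelic Heisenberg group, with no Weyl system in the statement

Topic `RepresentationTheory/HeisenbergGroup`; namespace `Literature.RepresentationTheory.HeisenbergGroup`.  KERNEL ONLY:
theorems; no definition, no named fact, no record, no `sorry`.

`WeylSystemLatticePairUniqueness.lean` proves von Neumann's uniqueness for a WEYL SYSTEM commuting with a lattice-pair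
Heisenberg action.  This file removes the Weyl system from the statement: the archimedean datum is an arbitrary
representation `π` of `Heisenberg B`, `B : X →ₗ[R] X →ₗ[R] R` over a commutative `ℝ`-algebra `R` (the shape of
`H(W_∞)` over `F ⊗ ℝ = ∏_{v∣∞} F_v`), on a Hilbert space by linear isometries, with continuous orbit maps on the
finite-dimensional real normed space `X` and central character `𝐞 ∘ ℓ` for a surjective `ℝ`-linear `ℓ : R → ℝ` whose
real commutator form `ℓ(B(y, y') - B(y', y))` is non-degenerate ([GelbartRogawski1991, §3.1 p. 454 L19–21]: "`ψ` non-trivial",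
at every archimedean place); the finite datum is a commuting representation `τ` of a polarised Heisenberg group
`Heisenberg (polar β)` with central character `ψ` and a dual lattice pair whose unit scalings shrink to `0`
(`DualLatticePair.lean`; [Weil1964, Chap. III n° 37–39] over `𝐀_fin`).  THEOREM
(**`exists_linearIsometryEquiv_of_irreducible_heisenberg_pair`**): two such `(E, π, τ)`, `E ≠ 0`, JOINTLY IRREDUCIBLE
(no closed subspace other than `⊥`, `⊤` invariant under all `π h` and `τ h'`), are unitarily equivalent by a `U`
intertwining both `π` and `τ`; `U` is unique up to a scalar of modulus one
(`linearIsometryEquiv_unique_of_heisenberg_pair`), and a bounded operator commuting with `π` and `τ` is a scalar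
(`exists_commutant_eq_smul_of_heisenberg_pair`).  §3 supplies the bookkeeping to apply this to ONE representation `Π`
of a group generated by two commuting images `ι₁(H₁) · ι₂(H₂)` (as `H_𝐀(W) = H(W_∞) · H(W_fin)`): invariance,
irreducibility and intertwining transfer between `Π` and the pair `(Π ∘ ι₁, Π ∘ ι₂)`.

Proof: `π` factors through the real Heisenberg group of `ℓ ∘ B` (`HeisenbergCentralCharacterReduction.pushforward`),
which in symplectic coordinates (`SegalBargmann.exists_symplecticCoords`) is a Weyl system
(`SegalBargmann.isWeylSystem_weylOfRepCoords`, `W(x) = 𝐞(½ B(y, y)) π(y, 0)`, `y = e⁻¹ x`); the operators `W(x)` and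
`π(h)` differ by unit scalars, so commuting with / invariance under / intertwining of `π` and of `W` are equivalent, and
`IsWeylSystem.exists_linearIsometryEquiv_of_irreducible_commuting_latticePair` applies.

What remains for the adelic `ρ_ψ` of the tree's `Prop311AsPrinted` after this file is bookkeeping only: exhibit
`H_𝐀(W)` as generated by commuting copies of `Heisenberg B_∞` (`R = F ⊗ ℝ`) and `Heisenberg (polar β_fin)`
(`HeisenbergCoboundary.lean`: `Heisenberg.map`, `halfAltPolarEquiv`), the adelic dual lattice pair, and the
non-triviality of `ψ` at every place.  Nothing of the cited sources is asserted.

## References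
* [vonNeumann1931] J. von Neumann, Math. Ann. 104 (1931) 570–578, §5.
* [Weil1964] A. Weil, Acta Math. 111 (1964), Chap. I n° 11, Chap. III n° 37–39.
* [GelbartRogawski1991] S. Gelbart, J. Rogawski, Invent. Math. 105 (1991), §3.1 p. 454 L17–27.
* [Folland1989] G. B. Folland, *Harmonic Analysis in Phase Space*, Princeton UP (1989), §1.5 Theorem (1.50).
-/

set_option autoImplicit false

noncomputable section

open MeasureTheory Complex Filter
open scoped InnerProductSpace ComplexConjugate Topology Pointwise FourierTransform

namespace Literature.RepresentationTheory.HeisenbergGroup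

open Literature.RepresentationTheory.Unitary Literature.Analysis.SegalBargmann

/-! ## §1 Two small facts about representations with central character `𝐞 ∘ ℓ` -/

section Central

variable {R : Type*} [CommRing R] [Algebra ℝ R] {X : Type*} [AddCommGroup X] [Module R X]
  {E : Type*} [AddCommGroup E] [Module ℂ E] (B : X →ₗ[R] X →ₗ[R] R) (ℓ : R →ₗ[ℝ] ℝ)
  (π : Representation ℂ (Heisenberg B) E)

/-- `π(y, t) = 𝐞(ℓ t) • π(y, 0)` when the centre acts by `𝐞 ∘ ℓ`. [cite: Folland1989, §1.5 Theorem (1.50)] -/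
theorem apply_mk_eq_fourierChar_ell_smul
    (hπz : ∀ (t : R) (v : E), π (Heisenberg.ofCenter B (Multiplicative.ofAdd t)) v = ((𝐞 (ℓ t) : Circle) : ℂ) • v)
    (y : X) (t : R) (v : E) : π ⟨y, t⟩ v = ((𝐞 (ℓ t) : Circle) : ℂ) • π ⟨y, 0⟩ v := by
  rw [← Heisenberg.ofVec_mul_ofCenter, map_mul, Module.End.mul_apply, hπz, map_smul]
  rfl

/-- a subspace invariant under the `π(y, 0)` is invariant under all of `π(H)`. [cite: Folland1989, §1.5 Theorem (1.50)] -/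
theorem apply_mem_of_forall_mk_zero_mem
    (hπz : ∀ (t : R) (v : E), π (Heisenberg.ofCenter B (Multiplicative.ofAdd t)) v = ((𝐞 (ℓ t) : Circle) : ℂ) • v)
    (K : Submodule ℂ E) (hK : ∀ (y : X), ∀ v ∈ K, π ⟨y, 0⟩ v ∈ K) (h : Heisenberg B) {v : E} (hv : v ∈ K) :
    π h v ∈ K := by
  obtain ⟨y, t⟩ := h
  rw [apply_mk_eq_fourierChar_ell_smul B ℓ π hπz]
  exact K.smul_mem _ (hK y v hv)

end Central

/-! ## §2 The uniqueness theorem for the pair `(π, τ)` -/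

section Pair

variable {R : Type*} [CommRing R] [Algebra ℝ R]
  {X : Type*} [NormedAddCommGroup X] [NormedSpace ℝ X] [FiniteDimensional ℝ X] [Module R X] [IsScalarTower ℝ R X]
  (B : X →ₗ[R] X →ₗ[R] R) (ℓ : R →ₗ[ℝ] ℝ)
  {Rf : Type*} [CommRing Rf] {Xf Yf : Type*} [AddCommGroup Xf] [Module Rf Xf] [AddCommGroup Yf] [Module Rf Yf]
  [TopologicalSpace Xf] [IsTopologicalAddGroup Xf] [ContinuousConstSMul Rf Xf]
  [TopologicalSpace Yf] [IsTopologicalAddGroup Yf] [ContinuousConstSMul Rf Yf]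
  (β : Xf →ₗ[Rf] Yf →ₗ[Rf] Rf) (ψ : AddChar Rf Circle) {B₁ : AddSubgroup Xf} {B₂ : AddSubgroup Yf}

/-- **the Weyl system of the archimedean part and its relation to `π`.**  For `π` a unitary representation of
`Heisenberg B` with central character `𝐞 ∘ ℓ`, `ℓ` onto, and symplectic coordinates `e` of `ℓ ∘ B`: the operators
`W(x) = 𝐞(½ ℓ B(y, y)) π(y, 0)`, `y = e⁻¹ x`, form a Weyl system; recorded here as the existence of a Weyl system `W` on
the phase space with `W(x) = c_x • π(e⁻¹x, 0)`, `c_x ∈ S¹` depending only on `(B, ℓ, e, x)`.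
[cite: Folland1989, §1.5 Theorem (1.50)] -/
theorem exists_isWeylSystem_of_centralChar {n : ℕ} (e : X ≃ₗ[ℝ] (Fin n → ℝ) × (Fin n → ℝ))
    (he : ∀ y y' : X, realForm B ℓ y y' - realForm B ℓ y' y = (e y).1 ⬝ᵥ (e y').2 - (e y').1 ⬝ᵥ (e y).2)
    (hℓ : Function.Surjective ℓ)
    {E : Type*} [NormedAddCommGroup E] [InnerProductSpace ℂ E]
    (π : Representation ℂ (Heisenberg B) E) (hπu : ∀ (h : Heisenberg B) (v : E), ‖π h v‖ = ‖v‖)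
    (hπc : ∀ v : E, Continuous fun y : X => π ⟨y, 0⟩ v)
    (hπz : ∀ (t : R) (v : E), π (Heisenberg.ofCenter B (Multiplicative.ofAdd t)) v = ((𝐞 (ℓ t) : Circle) : ℂ) • v) :
    ∃ W : PhaseSpace (Fin n) → E →L[ℂ] E, IsWeylSystem (Jrot (Fin n)) W ∧
      ∀ (x : PhaseSpace (Fin n)) (v : E),
        W x v = ((𝐞 (realForm B ℓ (e.symm (phaseEquiv (Fin n) x)) (e.symm (phaseEquiv (Fin n) x)) / 2) : Circle) : ℂ) •
          π ⟨e.symm (phaseEquiv (Fin n) x), 0⟩ v := by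
  obtain ⟨r₀, hr₀⟩ := hℓ 1
  set ρ := pushforward B ℓ π r₀ hπz hr₀ with hρ
  have hsurj : Function.Surjective (toRealHeisenberg B ℓ) := fun h => by
    obtain ⟨t, ht⟩ := hℓ h.t
    exact ⟨⟨h.v, t⟩, by rw [toRealHeisenberg_apply, ht]⟩
  have hρu : ∀ (h : Heisenberg (realForm B ℓ)) (v : E), ‖ρ h v‖ = ‖v‖ := fun h v => by
    obtain ⟨h', rfl⟩ := hsurj h
    rw [hρ, pushforward_toRealHeisenberg_apply, hπu]
  have hρc : ∀ v : E, Continuous fun y : X => ρ ⟨y, 0⟩ v := fun v => by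
    simp only [hρ, pushforward_mk_zero_apply]
    exact hπc v
  refine ⟨weylOfRepCoords (Fin n) (realForm B ℓ) e ρ hρu,
    isWeylSystem_weylOfRepCoords he hρc (pushforward_center B ℓ π r₀ hπz hr₀), fun x v => ?_⟩
  rw [weylOfRepCoords_apply, hρ, pushforward_mk_zero_apply]

/-- **Uniqueness for a real Heisenberg group times a commuting lattice-pair Heisenberg group.**  `π₁, π₂`
representations of `Heisenberg B` (`B` over a commutative `ℝ`-algebra `R`, on a finite-dimensional real normed space
`X`) by linear isometries with continuous orbit maps and central character `𝐞 ∘ ℓ`, `ℓ : R → ℝ` onto with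
`ℓ(B(y,y') − B(y',y))` non-degenerate; `τ₁, τ₂` representations of `Heisenberg (polar β)` by linear isometries with
continuous orbit maps and central character `ψ`, commuting with `πᵢ`; `(B₁, B₂)` a dual lattice pair for `ψ(β x y)`
with shrinking unit scalings; `Eᵢ ≠ 0` jointly irreducible.  Then there is a unitary `U : E₁ ≃ₗᵢ[ℂ] E₂` with
`U (π₁ h v) = π₂ h (U v)` and `U (τ₁ h' v) = τ₂ h' (U v)` — the uniqueness of `ρ_ψ` for a group of the shape
`H(W_∞) · H(W_fin)`. [cite: vonNeumann1931, §5] -/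
theorem exists_linearIsometryEquiv_of_irreducible_heisenberg_pair (hℓ : Function.Surjective ℓ)
    (hs : (realForm B ℓ - (realForm B ℓ).flip).Nondegenerate) (hB : IsDualLatticePair β ψ B₁ B₂)
    (hX : ∀ N ∈ 𝓝 (0 : Xf), ∃ a : Rfˣ, (((a : Rf) • B₁ : AddSubgroup Xf) : Set Xf) ⊆ N)
    (hY : ∀ N ∈ 𝓝 (0 : Yf), ∃ a : Rfˣ, (((a : Rf) • B₂ : AddSubgroup Yf) : Set Yf) ⊆ N)
    {E₁ : Type*} [NormedAddCommGroup E₁] [InnerProductSpace ℂ E₁] [CompleteSpace E₁] [Nontrivial E₁]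
    {E₂ : Type*} [NormedAddCommGroup E₂] [InnerProductSpace ℂ E₂] [CompleteSpace E₂] [Nontrivial E₂]
    (π₁ : Representation ℂ (Heisenberg B) E₁) (π₂ : Representation ℂ (Heisenberg B) E₂)
    (τ₁ : Representation ℂ (Heisenberg (polar β)) E₁) (τ₂ : Representation ℂ (Heisenberg (polar β)) E₂)
    (h₁πu : ∀ (h : Heisenberg B) (v : E₁), ‖π₁ h v‖ = ‖v‖) (h₂πu : ∀ (h : Heisenberg B) (v : E₂), ‖π₂ h v‖ = ‖v‖)
    (h₁πc : ∀ v : E₁, Continuous fun y : X => π₁ ⟨y, 0⟩ v) (h₂πc : ∀ v : E₂, Continuous fun y : X => π₂ ⟨y, 0⟩ v)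
    (h₁πz : ∀ (t : R) (v : E₁), π₁ (Heisenberg.ofCenter B (Multiplicative.ofAdd t)) v = ((𝐞 (ℓ t) : Circle) : ℂ) • v)
    (h₂πz : ∀ (t : R) (v : E₂), π₂ (Heisenberg.ofCenter B (Multiplicative.ofAdd t)) v = ((𝐞 (ℓ t) : Circle) : ℂ) • v)
    (h₁τu : ∀ (h : Heisenberg (polar β)) (v : E₁), ‖τ₁ h v‖ = ‖v‖)
    (h₂τu : ∀ (h : Heisenberg (polar β)) (v : E₂), ‖τ₂ h v‖ = ‖v‖)
    (h₁τc : ∀ v : E₁, Continuous fun w : Xf × Yf => τ₁ ⟨w, 0⟩ v)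
    (h₂τc : ∀ v : E₂, Continuous fun w : Xf × Yf => τ₂ ⟨w, 0⟩ v)
    (h₁τz : ∀ (t : Rf) (v : E₁), τ₁ (Heisenberg.ofCenter (polar β) (Multiplicative.ofAdd t)) v = ((ψ t : Circle) : ℂ) • v)
    (h₂τz : ∀ (t : Rf) (v : E₂), τ₂ (Heisenberg.ofCenter (polar β) (Multiplicative.ofAdd t)) v = ((ψ t : Circle) : ℂ) • v)
    (h₁comm : ∀ (h : Heisenberg B) (h' : Heisenberg (polar β)) (v : E₁), π₁ h (τ₁ h' v) = τ₁ h' (π₁ h v))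
    (h₂comm : ∀ (h : Heisenberg B) (h' : Heisenberg (polar β)) (v : E₂), π₂ h (τ₂ h' v) = τ₂ h' (π₂ h v))
    (h₁i : ∀ K : Submodule ℂ E₁, IsClosed (K : Set E₁) → (∀ (h : Heisenberg B), ∀ v ∈ K, π₁ h v ∈ K) →
      (∀ (h' : Heisenberg (polar β)), ∀ v ∈ K, τ₁ h' v ∈ K) → K = ⊥ ∨ K = ⊤)
    (h₂i : ∀ K : Submodule ℂ E₂, IsClosed (K : Set E₂) → (∀ (h : Heisenberg B), ∀ v ∈ K, π₂ h v ∈ K) →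
      (∀ (h' : Heisenberg (polar β)), ∀ v ∈ K, τ₂ h' v ∈ K) → K = ⊥ ∨ K = ⊤) :
    ∃ U : E₁ ≃ₗᵢ[ℂ] E₂, (∀ (h : Heisenberg B) (v : E₁), U (π₁ h v) = π₂ h (U v)) ∧
      ∀ (h' : Heisenberg (polar β)) (v : E₁), U (τ₁ h' v) = τ₂ h' (U v) := by
  -- symplectic coordinates of the real form, and the two Weyl systems
  obtain ⟨n, e, he⟩ := exists_symplecticCoords (realForm B ℓ) hs
  obtain ⟨W₁, hW₁, hW₁π⟩ := exists_isWeylSystem_of_centralChar B ℓ e he hℓ π₁ h₁πu h₁πc h₁πz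
  obtain ⟨W₂, hW₂, hW₂π⟩ := exists_isWeylSystem_of_centralChar B ℓ e he hℓ π₂ h₂πu h₂πc h₂πz
  -- `π(y, 0)` is a unit multiple of `W(x_y)`, `x_y` the point over `y`
  have hxy : ∀ y : X, e.symm (phaseEquiv (Fin n) ((phaseEquiv (Fin n)).symm (e y))) = y := fun y => by
    rw [LinearEquiv.apply_symm_apply, LinearEquiv.symm_apply_apply]
  have hπ₁W : ∀ (y : X) (v : E₁), π₁ ⟨y, 0⟩ v = (((𝐞 (realForm B ℓ y y / 2) : Circle) : ℂ))⁻¹ •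
      W₁ ((phaseEquiv (Fin n)).symm (e y)) v := fun y v => by
    rw [hW₁π, hxy, smul_smul, inv_mul_cancel₀ (Circle.coe_ne_zero _), one_smul]
  have hπ₂W : ∀ (y : X) (v : E₂), π₂ ⟨y, 0⟩ v = (((𝐞 (realForm B ℓ y y / 2) : Circle) : ℂ))⁻¹ •
      W₂ ((phaseEquiv (Fin n)).symm (e y)) v := fun y v => by
    rw [hW₂π, hxy, smul_smul, inv_mul_cancel₀ (Circle.coe_ne_zero _), one_smul]
  -- hypotheses of the Weyl-system theorem
  have h₁W : ∀ (h' : Heisenberg (polar β)) (x : PhaseSpace (Fin n)) (v : E₁), τ₁ h' (W₁ x v) = W₁ x (τ₁ h' v) := by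
    intro h' x v
    rw [hW₁π, hW₁π, map_smul, h₁comm]
  have h₂W : ∀ (h' : Heisenberg (polar β)) (x : PhaseSpace (Fin n)) (v : E₂), τ₂ h' (W₂ x v) = W₂ x (τ₂ h' v) := by
    intro h' x v
    rw [hW₂π, hW₂π, map_smul, h₂comm]
  have h₁i' : ∀ K : Submodule ℂ E₁, IsClosed (K : Set E₁) → (∀ (x : PhaseSpace (Fin n)), ∀ v ∈ K, W₁ x v ∈ K) →
      (∀ (h' : Heisenberg (polar β)), ∀ v ∈ K, τ₁ h' v ∈ K) → K = ⊥ ∨ K = ⊤ := by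
    intro K hKc hKW hKτ
    refine h₁i K hKc (fun h v hv => apply_mem_of_forall_mk_zero_mem B ℓ π₁ h₁πz K (fun y w hw => ?_) h hv) hKτ
    rw [hπ₁W]
    exact K.smul_mem _ (hKW _ w hw)
  have h₂i' : ∀ K : Submodule ℂ E₂, IsClosed (K : Set E₂) → (∀ (x : PhaseSpace (Fin n)), ∀ v ∈ K, W₂ x v ∈ K) →
      (∀ (h' : Heisenberg (polar β)), ∀ v ∈ K, τ₂ h' v ∈ K) → K = ⊥ ∨ K = ⊤ := by
    intro K hKc hKW hKτ
    refine h₂i K hKc (fun h v hv => apply_mem_of_forall_mk_zero_mem B ℓ π₂ h₂πz K (fun y w hw => ?_) h hv) hKτ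
    rw [hπ₂W]
    exact K.smul_mem _ (hKW _ w hw)
  obtain ⟨U, hUW, hUτ⟩ := hW₁.exists_linearIsometryEquiv_of_irreducible_commuting_latticePair β ψ hW₂ τ₁ τ₂ h₁τu h₂τu
    h₁W h₂W h₁τc h₂τc h₁τz h₂τz h₁i' h₂i' hB hX hY
  refine ⟨U, fun h v => ?_, hUτ⟩
  obtain ⟨y, t⟩ := h
  rw [apply_mk_eq_fourierChar_ell_smul B ℓ π₁ h₁πz, apply_mk_eq_fourierChar_ell_smul B ℓ π₂ h₂πz, map_smul, hπ₁W,
    hπ₂W, map_smul, hUW]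

/-- **the intertwiner of the pair is unique up to `S¹`**: with `π₁, τ₁` as above on `E₁ ≠ 0` (jointly irreducible),
two unitaries `U₁, U₂ : E₁ ≃ₗᵢ[ℂ] E₂` intertwining `π₁, π₂` and `τ₁, τ₂` satisfy `U₂ = c • U₁`, `‖c‖ = 1` — the kernel
`ℂˣ` of `(g, M_g) ↦ g` for the adelic group of pairs. [cite: vonNeumann1931, §5] -/
theorem linearIsometryEquiv_unique_of_heisenberg_pair (hℓ : Function.Surjective ℓ)
    (hs : (realForm B ℓ - (realForm B ℓ).flip).Nondegenerate) (hB : IsDualLatticePair β ψ B₁ B₂)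
    (hX : ∀ N ∈ 𝓝 (0 : Xf), ∃ a : Rfˣ, (((a : Rf) • B₁ : AddSubgroup Xf) : Set Xf) ⊆ N)
    (hY : ∀ N ∈ 𝓝 (0 : Yf), ∃ a : Rfˣ, (((a : Rf) • B₂ : AddSubgroup Yf) : Set Yf) ⊆ N)
    {E₁ : Type*} [NormedAddCommGroup E₁] [InnerProductSpace ℂ E₁] [CompleteSpace E₁] [Nontrivial E₁]
    {E₂ : Type*} [NormedAddCommGroup E₂] [InnerProductSpace ℂ E₂]
    (π₁ : Representation ℂ (Heisenberg B) E₁) (π₂ : Representation ℂ (Heisenberg B) E₂)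
    (τ₁ : Representation ℂ (Heisenberg (polar β)) E₁) (τ₂ : Representation ℂ (Heisenberg (polar β)) E₂)
    (h₁πu : ∀ (h : Heisenberg B) (v : E₁), ‖π₁ h v‖ = ‖v‖)
    (h₁πc : ∀ v : E₁, Continuous fun y : X => π₁ ⟨y, 0⟩ v)
    (h₁πz : ∀ (t : R) (v : E₁), π₁ (Heisenberg.ofCenter B (Multiplicative.ofAdd t)) v = ((𝐞 (ℓ t) : Circle) : ℂ) • v)
    (h₁τu : ∀ (h : Heisenberg (polar β)) (v : E₁), ‖τ₁ h v‖ = ‖v‖)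
    (h₁τc : ∀ v : E₁, Continuous fun w : Xf × Yf => τ₁ ⟨w, 0⟩ v)
    (h₁τz : ∀ (t : Rf) (v : E₁), τ₁ (Heisenberg.ofCenter (polar β) (Multiplicative.ofAdd t)) v = ((ψ t : Circle) : ℂ) • v)
    (h₁comm : ∀ (h : Heisenberg B) (h' : Heisenberg (polar β)) (v : E₁), π₁ h (τ₁ h' v) = τ₁ h' (π₁ h v))
    (h₁i : ∀ K : Submodule ℂ E₁, IsClosed (K : Set E₁) → (∀ (h : Heisenberg B), ∀ v ∈ K, π₁ h v ∈ K) →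
      (∀ (h' : Heisenberg (polar β)), ∀ v ∈ K, τ₁ h' v ∈ K) → K = ⊥ ∨ K = ⊤)
    (U₁ U₂ : E₁ ≃ₗᵢ[ℂ] E₂)
    (hU₁π : ∀ (h : Heisenberg B) (v : E₁), U₁ (π₁ h v) = π₂ h (U₁ v))
    (hU₁τ : ∀ (h' : Heisenberg (polar β)) (v : E₁), U₁ (τ₁ h' v) = τ₂ h' (U₁ v))
    (hU₂π : ∀ (h : Heisenberg B) (v : E₁), U₂ (π₁ h v) = π₂ h (U₂ v))
    (hU₂τ : ∀ (h' : Heisenberg (polar β)) (v : E₁), U₂ (τ₁ h' v) = τ₂ h' (U₂ v)) :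
    ∃ c : ℂ, ‖c‖ = 1 ∧ ∀ v : E₁, U₂ v = c • U₁ v := by
  obtain ⟨n, e, he⟩ := exists_symplecticCoords (realForm B ℓ) hs
  obtain ⟨W₁, hW₁, hW₁π⟩ := exists_isWeylSystem_of_centralChar B ℓ e he hℓ π₁ h₁πu h₁πc h₁πz
  -- the Weyl system of `π₂` on the nose: `W₂ x = c_x • π₂(e⁻¹x, 0)` as bounded operators moved along `U₁`
  set W₂ : PhaseSpace (Fin n) → E₂ →L[ℂ] E₂ := fun x =>
    (U₁.toContinuousLinearEquiv : E₁ →L[ℂ] E₂).comp ((W₁ x).comp (U₁.symm.toContinuousLinearEquiv : E₂ →L[ℂ] E₁))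
    with hW₂def
  have hW₂ : ∀ (x : PhaseSpace (Fin n)) (w : E₂), W₂ x w = U₁ (W₁ x (U₁.symm w)) := fun x w => rfl
  have h₁W : ∀ (h' : Heisenberg (polar β)) (x : PhaseSpace (Fin n)) (v : E₁), τ₁ h' (W₁ x v) = W₁ x (τ₁ h' v) := by
    intro h' x v
    rw [hW₁π, hW₁π, map_smul, h₁comm]
  have h₁i' : ∀ K : Submodule ℂ E₁, IsClosed (K : Set E₁) → (∀ (x : PhaseSpace (Fin n)), ∀ v ∈ K, W₁ x v ∈ K) →
      (∀ (h' : Heisenberg (polar β)), ∀ v ∈ K, τ₁ h' v ∈ K) → K = ⊥ ∨ K = ⊤ := by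
    have hc0 : ∀ x : PhaseSpace (Fin n),
        ((𝐞 (realForm B ℓ (e.symm (phaseEquiv (Fin n) x)) (e.symm (phaseEquiv (Fin n) x)) / 2) : Circle) : ℂ) ≠ 0 :=
      fun x => Circle.coe_ne_zero _
    have hxy : ∀ y : X, e.symm (phaseEquiv (Fin n) ((phaseEquiv (Fin n)).symm (e y))) = y := fun y => by
      rw [LinearEquiv.apply_symm_apply, LinearEquiv.symm_apply_apply]
    intro K hKc hKW hKτ
    refine h₁i K hKc (fun h v hv => apply_mem_of_forall_mk_zero_mem B ℓ π₁ h₁πz K (fun y w hw => ?_) h hv) hKτ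
    have h1 := hW₁π ((phaseEquiv (Fin n)).symm (e y)) w
    rw [hxy] at h1
    have h2 : π₁ ⟨y, 0⟩ w = (((𝐞 (realForm B ℓ y y / 2) : Circle) : ℂ))⁻¹ • W₁ ((phaseEquiv (Fin n)).symm (e y)) w := by
      rw [h1, smul_smul, inv_mul_cancel₀ (Circle.coe_ne_zero _), one_smul]
    rw [h2]
    exact K.smul_mem _ (hKW _ w hw)
  -- both `U₁` and `U₂` intertwine `W₁` with `W₂`
  have hU₁W : ∀ (x : PhaseSpace (Fin n)) (v : E₁), U₁ (W₁ x v) = W₂ x (U₁ v) := fun x v => by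
    rw [hW₂, LinearIsometryEquiv.symm_apply_apply]
  have hU₂W : ∀ (x : PhaseSpace (Fin n)) (v : E₁), U₂ (W₁ x v) = W₂ x (U₂ v) := fun x v => by
    rw [hW₂, hW₁π, hW₁π, map_smul, map_smul, hU₂π, hU₁π, LinearIsometryEquiv.apply_symm_apply]
  exact hW₁.linearIsometryEquiv_unique_of_commuting_latticePair β ψ τ₁ h₁τu h₁W h₁τc h₁τz h₁i' hB hX hY τ₂ U₁ U₂
    hU₁W hU₁τ hU₂W hU₂τ

/-- **Schur for the pair `(π, τ)`**: with `π, τ` as above on `E ≠ 0` (jointly irreducible), a bounded operator commuting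
with all `π h` and all `τ h'` is a scalar (it commutes with the Weyl system of `π`, and
`IsWeylSystem.exists_commutant_eq_smul_of_commuting_latticePair` applies). [cite: vonNeumann1931, §5] -/
theorem exists_commutant_eq_smul_of_heisenberg_pair (hℓ : Function.Surjective ℓ)
    (hs : (realForm B ℓ - (realForm B ℓ).flip).Nondegenerate) (hB : IsDualLatticePair β ψ B₁ B₂)
    (hX : ∀ N ∈ 𝓝 (0 : Xf), ∃ a : Rfˣ, (((a : Rf) • B₁ : AddSubgroup Xf) : Set Xf) ⊆ N)
    (hY : ∀ N ∈ 𝓝 (0 : Yf), ∃ a : Rfˣ, (((a : Rf) • B₂ : AddSubgroup Yf) : Set Yf) ⊆ N)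
    {E : Type*} [NormedAddCommGroup E] [InnerProductSpace ℂ E] [CompleteSpace E] [Nontrivial E]
    (π : Representation ℂ (Heisenberg B) E) (τ : Representation ℂ (Heisenberg (polar β)) E)
    (hπu : ∀ (h : Heisenberg B) (v : E), ‖π h v‖ = ‖v‖) (hπc : ∀ v : E, Continuous fun y : X => π ⟨y, 0⟩ v)
    (hπz : ∀ (t : R) (v : E), π (Heisenberg.ofCenter B (Multiplicative.ofAdd t)) v = ((𝐞 (ℓ t) : Circle) : ℂ) • v)
    (hτu : ∀ (h : Heisenberg (polar β)) (v : E), ‖τ h v‖ = ‖v‖)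
    (hτc : ∀ v : E, Continuous fun w : Xf × Yf => τ ⟨w, 0⟩ v)
    (hτz : ∀ (t : Rf) (v : E), τ (Heisenberg.ofCenter (polar β) (Multiplicative.ofAdd t)) v = ((ψ t : Circle) : ℂ) • v)
    (hcomm : ∀ (h : Heisenberg B) (h' : Heisenberg (polar β)) (v : E), π h (τ h' v) = τ h' (π h v))
    (hirr : ∀ K : Submodule ℂ E, IsClosed (K : Set E) → (∀ (h : Heisenberg B), ∀ v ∈ K, π h v ∈ K) →
      (∀ (h' : Heisenberg (polar β)), ∀ v ∈ K, τ h' v ∈ K) → K = ⊥ ∨ K = ⊤)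
    (A : E →L[ℂ] E) (hAπ : ∀ (h : Heisenberg B) (v : E), A (π h v) = π h (A v))
    (hAτ : ∀ (h' : Heisenberg (polar β)) (v : E), A (τ h' v) = τ h' (A v)) :
    ∃ c : ℂ, ∀ v : E, A v = c • v := by
  obtain ⟨n, e, he⟩ := exists_symplecticCoords (realForm B ℓ) hs
  obtain ⟨W, hW, hWπ⟩ := exists_isWeylSystem_of_centralChar B ℓ e he hℓ π hπu hπc hπz
  have hxy : ∀ y : X, e.symm (phaseEquiv (Fin n) ((phaseEquiv (Fin n)).symm (e y))) = y := fun y => by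
    rw [LinearEquiv.apply_symm_apply, LinearEquiv.symm_apply_apply]
  have hπW : ∀ (y : X) (v : E), π ⟨y, 0⟩ v = (((𝐞 (realForm B ℓ y y / 2) : Circle) : ℂ))⁻¹ •
      W ((phaseEquiv (Fin n)).symm (e y)) v := fun y v => by
    rw [hWπ, hxy, smul_smul, inv_mul_cancel₀ (Circle.coe_ne_zero _), one_smul]
  have hτW : ∀ (h' : Heisenberg (polar β)) (x : PhaseSpace (Fin n)) (v : E), τ h' (W x v) = W x (τ h' v) := by
    intro h' x v
    rw [hWπ, hWπ, map_smul, hcomm]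
  have hirr' : ∀ K : Submodule ℂ E, IsClosed (K : Set E) → (∀ (x : PhaseSpace (Fin n)), ∀ v ∈ K, W x v ∈ K) →
      (∀ (h' : Heisenberg (polar β)), ∀ v ∈ K, τ h' v ∈ K) → K = ⊥ ∨ K = ⊤ := by
    intro K hKc hKW hKτ
    refine hirr K hKc (fun h v hv => apply_mem_of_forall_mk_zero_mem B ℓ π hπz K (fun y w hw => ?_) h hv) hKτ
    rw [hπW]
    exact K.smul_mem _ (hKW _ w hw)
  have hAW : ∀ (x : PhaseSpace (Fin n)) (v : E), A (W x v) = W x (A v) := fun x v => by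
    rw [hWπ, hWπ, map_smul, hAπ]
  exact hW.exists_commutant_eq_smul_of_commuting_latticePair β ψ τ hτu hτW hτc hτz hirr' hB hX hY A hAW hAτ

end Pair

/-! ## §3 From one representation of a group generated by two commuting images -/

section Generated

variable {G H₁ H₂ : Type*} [Group G] [Group H₁] [Group H₂] (ι₁ : H₁ →* G) (ι₂ : H₂ →* G)
  {E : Type*} [AddCommGroup E] [Module ℂ E] (Θ : Representation ℂ G E)

/-- **invariance transfers to the generated group**: if every `g ∈ G` is a product `ι₁ h₁ · ι₂ h₂` (e.g.
`H_𝐀(W) = H(W_∞) · H(W_fin)`), a subspace invariant under `Θ ∘ ι₁` and `Θ ∘ ι₂` is invariant under `Θ`.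
[cite: GelbartRogawski1991, §3.1 p. 454 L17–21] -/
theorem apply_mem_of_generated (hgen : ∀ g : G, ∃ (h₁ : H₁) (h₂ : H₂), g = ι₁ h₁ * ι₂ h₂) (K : Submodule ℂ E)
    (hK₁ : ∀ (h : H₁), ∀ v ∈ K, Θ (ι₁ h) v ∈ K) (hK₂ : ∀ (h : H₂), ∀ v ∈ K, Θ (ι₂ h) v ∈ K) (g : G) {v : E}
    (hv : v ∈ K) : Θ g v ∈ K := by
  obtain ⟨h₁, h₂, rfl⟩ := hgen g
  rw [map_mul, Module.End.mul_apply]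
  exact hK₁ h₁ _ (hK₂ h₂ v hv)

/-- **joint irreducibility from irreducibility**: with `G` generated as above, if `Θ` has no closed invariant subspace
other than `⊥`, `⊤`, then neither has the pair `(Θ ∘ ι₁, Θ ∘ ι₂)`. [cite: GelbartRogawski1991, §3.1 p. 454 L17–21] -/
theorem jointly_irreducible_of_generated [TopologicalSpace E] (hgen : ∀ g : G, ∃ (h₁ : H₁) (h₂ : H₂), g = ι₁ h₁ * ι₂ h₂)
    (hirr : ∀ K : Submodule ℂ E, IsClosed (K : Set E) → (∀ (g : G), ∀ v ∈ K, Θ g v ∈ K) → K = ⊥ ∨ K = ⊤)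
    (K : Submodule ℂ E) (hKc : IsClosed (K : Set E)) (hK₁ : ∀ (h : H₁), ∀ v ∈ K, Θ (ι₁ h) v ∈ K)
    (hK₂ : ∀ (h : H₂), ∀ v ∈ K, Θ (ι₂ h) v ∈ K) : K = ⊥ ∨ K = ⊤ :=
  hirr K hKc fun g _ hv => apply_mem_of_generated ι₁ ι₂ Θ hgen K hK₁ hK₂ g hv

/-- **intertwining transfers to the generated group**: a map intertwining `Θ ∘ ι₁` and `Θ ∘ ι₂` with `Θ' ∘ ι₁` and
`Θ' ∘ ι₂` intertwines `Θ` with `Θ'`. [cite: GelbartRogawski1991, §3.1 p. 454 L17–21] -/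
theorem intertwines_of_generated (hgen : ∀ g : G, ∃ (h₁ : H₁) (h₂ : H₂), g = ι₁ h₁ * ι₂ h₂)
    {E' : Type*} [AddCommGroup E'] [Module ℂ E'] (Θ' : Representation ℂ G E') {F : Type*} [FunLike F E E']
    (U : F) (hU₁ : ∀ (h : H₁) (v : E), U (Θ (ι₁ h) v) = Θ' (ι₁ h) (U v))
    (hU₂ : ∀ (h : H₂) (v : E), U (Θ (ι₂ h) v) = Θ' (ι₂ h) (U v)) (g : G) (v : E) : U (Θ g v) = Θ' g (U v) := by
  obtain ⟨h₁, h₂, rfl⟩ := hgen g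
  rw [map_mul, Module.End.mul_apply, hU₁, hU₂, map_mul, Module.End.mul_apply]

/-- the components of a representation by isometries are representations by isometries (restatement for `Θ ∘ ι`).
[cite: GelbartRogawski1991, §3.1 p. 454 L17–21] -/
theorem norm_comp_apply {E₀ : Type*} [NormedAddCommGroup E₀] [NormedSpace ℂ E₀] (Θ₀ : Representation ℂ G E₀)
    (hu : ∀ (g : G) (v : E₀), ‖Θ₀ g v‖ = ‖v‖) (h : H₁) (v : E₀) : ‖(Θ₀.comp ι₁) h v‖ = ‖v‖ :=
  hu (ι₁ h) v

end Generated

end Literature.RepresentationTheory.HeisenbergGroup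

end

/-! ## §4 (appendix) From one representation pulled back along a surjective homomorphism -/

namespace Literature.RepresentationTheory.HeisenbergGroup

section Surjective

variable {G G' : Type*} [Group G] [Group G'] (p : G' →* G) {E : Type*} [AddCommGroup E] [Module ℂ E]
  (Θ : Representation ℂ G E)

/-- **invariance along a surjection**: for `p : G' ↠ G`, a subspace invariant under `Θ ∘ p` is invariant under `Θ`
(e.g. `H_𝐀(W) ↠ Heisenberg (polar β_𝐀)` in adelic Darboux coordinates). [cite: GelbartRogawski1991, §3.1 p. 454 L17–21] -/
theorem apply_mem_of_comp_surjective (hp : Function.Surjective p) (K : Submodule ℂ E)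
    (hK : ∀ (g' : G'), ∀ v ∈ K, (Θ.comp p) g' v ∈ K) (g : G) {v : E} (hv : v ∈ K) : Θ g v ∈ K := by
  obtain ⟨g', rfl⟩ := hp g
  exact hK g' v hv

/-- **irreducibility along a surjection**: for `p : G' ↠ G`, `Θ` has no closed invariant subspace other than `⊥`, `⊤`
iff `Θ ∘ p` has none (the two families of operators coincide). [cite: GelbartRogawski1991, §3.1 p. 454 L17–21] -/
theorem irreducible_comp_iff_of_surjective [TopologicalSpace E] (hp : Function.Surjective p) :
    (∀ K : Submodule ℂ E, IsClosed (K : Set E) → (∀ (g' : G'), ∀ v ∈ K, (Θ.comp p) g' v ∈ K) → K = ⊥ ∨ K = ⊤) ↔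
      ∀ K : Submodule ℂ E, IsClosed (K : Set E) → (∀ (g : G), ∀ v ∈ K, Θ g v ∈ K) → K = ⊥ ∨ K = ⊤ := by
  constructor
  · intro h K hKc hK
    exact h K hKc fun g' v hv => hK (p g') v hv
  · intro h K hKc hK
    exact h K hKc fun g v hv => apply_mem_of_comp_surjective p Θ hp K hK g hv

/-- isometries pull back to isometries along any homomorphism. [cite: GelbartRogawski1991, §3.1 p. 454 L17–21] -/
theorem norm_comp_apply' {E₀ : Type*} [NormedAddCommGroup E₀] [NormedSpace ℂ E₀] (Θ₀ : Representation ℂ G E₀)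
    (hu : ∀ (g : G) (v : E₀), ‖Θ₀ g v‖ = ‖v‖) (g' : G') (v : E₀) : ‖(Θ₀.comp p) g' v‖ = ‖v‖ :=
  hu (p g') v

end Surjective

end Literature.RepresentationTheory.HeisenbergGroup
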